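import Literature.Analysis.FluidPDE.BarkerPrangeConcentrationHolds
import Literature.Analysis.FluidPDE.LocalEnergySliceE3
import Literature.Analysis.FluidPDE.SuitableWeakInBallTools
import Literature.Analysis.FluidPDE.SereginEpsilonRegularityGradientOfBounds
import Literature.Analysis.FluidPDE.NSBoundedHigherRegularityQuantProofs
import HarnessLib

/-!
# Barker–Prange 2020, Theorem 1: the QUANTITATIVE slab form (sup bounds on `v` and on `∇v`)

Analysis/FluidPDE proof file (theorems only, no definitions, no named facts). It sharpens the
tree's theorem `Literature.Analysis.FluidPDE.BarkerPrange2020_thm1_slab`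
(`BarkerPrangeConcentrationHolds.lean`: T. Barker, C. Prange, *Localized smoothing for the
Navier–Stokes equations and concentration of critical norms near singularities*, Arch. Ration.
Mech. Anal. 236 (2020) 1487–1541 = arXiv:1812.09115, **Theorem 1** in the slab form used by the
paper's §4.2), whose conclusion is the QUALITATIVE one printed in Theorem 1,
"`u ∈ L^∞(B_{1/3}(0) × (β, S*(M)))` for all `β ∈ (0, S*(M))`" (arXiv p. 2), to the quantitative
form in which the localized smoothing is used as an *envelope*:

* `BarkerPrange2020_thm1_slab_bounds` — there are a universal `γ > 0` and, for every `M > 0`, a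
  time `S = S(M) ∈ (0, ¼]` and, for every `β ∈ (0, S)`, constants `C = C(M, β)`, `C₁ = C₁(M, β)`
  fixed BEFORE the solution, such that every local energy solution `(v, π)` on `ℝ³ × (0, S)`
  (unit viscosity, Seregin's class `IsLocalEnergySolutionOn S 1 v₀ v π`) with datum `v₀ ∈ E²`,
  `‖v₀‖_{L²(B₁(x̄))} ≤ M` for all `x̄`, `‖v₀‖_{L³(B₂(0))} ≤ γ`, satisfies
  `|v| ≤ C` a.e. on `(β, S) × B_{1/3}(0)` (so `‖v‖_{L^∞((β,S) × B_{1/3})} ≤ C`), and EVERY weak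
  spatial gradient `G = ∇v` of `v` on the open strip `(0, S) × ℝ³` satisfies `|G| ≤ C₁` a.e. on
  `(β, S) × B_{1/3}(0)` (`|G| = √(frobeniusNormSq G)`, the Euclidean matrix norm).

What is printed and what is proved here. The velocity bound with a constant depending only on
the data of the statement is the content of Kang–Miura–Tsai, IMRN 2021 = arXiv:1812.10509,
**Thm. 1.1 / Cor. 1.2** ("`v` is regular in `B_{1/4} × (0, T₁)` with `|v(x,t)| ≤ C₁/√t`", `C₁`
independent of `M`, `T₁ = T₁(M)`), proved there, as here, by the Caffarelli–Kohn–Nirenberg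
criterion `C(r) + D(r) ≤ ε_CKN ⇒ ‖v‖_{L^∞(Q_{r/2})} ≤ C_CKN / r` (their Lemma 2.1); Barker–Prange
remark after Theorem 1 that "the solution `u` is bounded in `B_{1/2}(0) × (0, S*(M))`, hence smooth
in space" (arXiv p. 2). The GRADIENT bound is the case `k = 2` of the same ε-regularity lemma
(Seregin 2014, Ch. 6, Lemma 6.1; in the tree as the PROVED fact `seregin2014_lemma61_gradient`,
discharged by `seregin2014_lemma61_gradient_of_higherRegularityBounds
NSBoundedHigherRegularityBounds_holds`), applied on the very cylinders on which the tree's proof of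
`BarkerPrange2020_thm1_slab` applies the case `k = 1`. Nothing printed is asserted beyond what is
proved: the file contains theorems only.

## Proof

The proof of `BarkerPrange2020_thm1_slab` (module docstring of `BarkerPrangeConcentrationHolds`
and `InitialTimeCKNStep3`) is repeated with its constants kept: gauge and zero extension
(`InitialTimeCKNExtension`), unit-scale smallness for `S ≤ S(M)` (`InitialTimeCKNSmallness`),
the initial-time Caffarelli–Kohn–Nirenberg induction `C(r_n) + D_osc(r_n) ≤ ε₀^{2/3}` at every
apex `z = (t, x̄)`, `0 < t < S`, `|x̄| < ½`, and every dyadic scale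
(`BarkerPrange2020.initialInduction`), and, at the dyadic scale `r = r(β) ≤ ¼` with `r² < β`, on
the interior cylinders `Q_r(z)`, `t ∈ (β, S)`:

* the proved ε-regularity theorem `lemarieRieusset_epsilon_regularity_holds` (velocity:
  `|v| ≤ C₀ ε_L / r` a.e. on `Q_{r/2}(z)`), exactly as before, and
* the proved gradient ε-regularity `seregin2014_lemma61_gradient` on the Navier–Stokes zoom of
  `Q_r(z)` to `Q(0,1)` (`IsSuitableWeakSolutionOn.isSuitableWeakSolutionInBall`,
  `IsSuitableWeakSolutionInBall.zoom`, `HasWeakSpatialGradientOn.stRescale`; smallness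
  `∫_{Q(0,1)} (|U|³ + |P|^{3/2}) = r⁻² ∫_{Q_r(z)} (|v|³ + |p|^{3/2}) ≤ ε₀^{2/3} < ε_{6.1}` by the choice
  of `ε₀`), transported back along the zoom: `|∇v| ≤ c₀₂ / r²` a.e. on `Q_{r/2}(z)`
  (`BarkerPrange2020.ae_gradient_bound_of_small`, the general-cylinder form of the step
  "Lemma 6.1 and the Navier–Stokes scaling", Seregin 2014 p. 100);

followed by the same countable covering of `(β, S) × B_{1/3}(0)` by cylinders `Q_{r/2}(z)` with
admissible apices. The constants `C = C₀ ε_L / r(β)`, `C₁ = c₀₂ / r(β)²` depend on `β` and on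
universal constants only.

## References

* T. Barker, C. Prange, Arch. Ration. Mech. Anal. 236 (2020) 1487–1541 = arXiv:1812.09115:
  Thm. 1 (p. 2) and the remark following it; §4.1. [BarkerPrange2020]
* K. Kang, H. Miura, T.-P. Tsai, IMRN 2021 = arXiv:1812.10509: Thm. 1.1, Cor. 1.2, Lemma 2.1.
  [KangMiuraTsai2020]
* G. Seregin, *Lecture Notes on Regularity Theory for the Navier–Stokes Equations* (2014), Ch. 6,
  Lemma 6.1 (PDF p. 90) and p. 100 ("Lemma 6.1 and the Navier–Stokes scaling"). [Seregin2014]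
* L. Caffarelli, R. Kohn, L. Nirenberg, Comm. Pure Appl. Math. 35 (1982) 771–831, §2.
  [CaffarelliKohnNirenberg1982]
-/

noncomputable section

open MeasureTheory Set Function Filter Topology TopologicalSpace Metric
open scoped NNReal ENNReal InnerProductSpace RealInnerProductSpace Laplacian

namespace Literature.Analysis.FluidPDE

open RRS2016 BarkerPrange2020

/-! ### The gradient ε-regularity bound on an interior cylinder of any scale -/

/-- **The smallness quantity under the Navier–Stokes zoom** `Φ(s, y) = (t + r² s, x + r y)` of
`Q_r(z)` onto `Q(0, 1)`: `∫_{Q(0,1)} (|U|³ + |P|^{3/2}) = r⁻² ∫_{Q_r(z)} (|v|³ + |p|^{3/2})` for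
`U = r v ∘ Φ`, `P = r² p ∘ Φ` (the accepted `lintegral_cubic_add_pressure_stRescale` at `ν = 1`;
"Lemma 6.1 and the Navier–Stokes scaling", Seregin 2014, p. 100; CKN 1982, §2, scale invariance of
`C` and `D`). [cite: Seregin2014, Ch. 6 p. 100 (the Navier–Stokes scaling of (6.1.5)); CaffarelliKohnNirenberg1982, §2] -/
theorem BarkerPrange2020.lintegral_cube_add_pressure_zoom {r : ℝ} (hr : 0 < r)
    (z : ℝ × EuclideanSpace ℝ (Fin 3))
    (v : ℝ → EuclideanSpace ℝ (Fin 3) → EuclideanSpace ℝ (Fin 3))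
    (p : ℝ → EuclideanSpace ℝ (Fin 3) → ℝ) :
    ∫⁻ w in parabolicCylinder 1 ((0 : ℝ), (0 : EuclideanSpace ℝ (Fin 3))),
        (‖(r • stPull (r ^ 2) r z.1 z.2 v) w.1 w.2‖ₑ ^ (3 : ℕ) +
          ‖(r ^ 2 • stPull (r ^ 2) r z.1 z.2 p) w.1 w.2‖ₑ ^ (3 / 2 : ℝ)) =
      ENNReal.ofReal ((r ^ 2)⁻¹) *
        ∫⁻ w in parabolicCylinder r z, (‖v w.1 w.2‖ₑ ^ (3 : ℕ) + ‖p w.1 w.2‖ₑ ^ (3 / 2 : ℝ)) := by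
  have h := lintegral_cubic_add_pressure_stRescale one_pos hr z.1 z.2 v p
  simp only [div_one, one_pow, one_mul, viscousCylinder_one] at h
  exact h

/-- **Gradient ε-regularity on an interior cylinder of any scale** ("Lemma 6.1 and the
Navier–Stokes scaling", Seregin 2014, p. 100; CKN 1982, §2): let `H` be the ε-regularity bound for
the gradient on the unit cylinder in a.e. form — the shape of
`seregin2014_lemma61_gradient.ae_bound` (Seregin 2014, Lemma 6.1, `k = 2`), with constants
`ε₂, c₀₂`. If `(v, p)` is a suitable weak solution on an open `Q` containing the closed box of
`Q_r(z)`, `G` is any weak spatial gradient of `v` on `Q`, and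
`∫_{Q_r(z)} (|v|³ + |p|^{3/2}) < ε₂ r²`, then `|G| ≤ c₀₂ / r²` a.e. on `Q_{r/2}(z)`: zoom `Q_r(z)`
onto `Q(0, 1)` (`IsSuitableWeakSolutionOn.isSuitableWeakSolutionInBall`,
`IsSuitableWeakSolutionInBall.zoom`, `HasWeakSpatialGradientOn.stRescale`), apply `H` to the
zoomed pair, whose smallness quantity is `r⁻² ∫_{Q_r(z)} (|v|³ + |p|^{3/2})`
(`lintegral_cube_add_pressure_zoom`) and whose weak gradient is `r² G ∘ Φ`, and transport the bound
`|r² G ∘ Φ| < c₀₂` on `Q(0, ½) = Φ⁻¹(Q_{r/2}(z))` back along `Φ`. [cite: Seregin2014, Ch. 6 §6.1 Lemma 6.1 with p. 100 (the Navier–Stokes scaling)] -/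
theorem BarkerPrange2020.ae_gradient_bound_of_small {ε₂ c₀₂ : ℝ}
    (H : ∀ (U : ℝ → EuclideanSpace ℝ (Fin 3) → EuclideanSpace ℝ (Fin 3))
        (P : ℝ → EuclideanSpace ℝ (Fin 3) → ℝ)
        (G : ℝ → EuclideanSpace ℝ (Fin 3) → EuclideanSpace ℝ (Fin 3) →L[ℝ] EuclideanSpace ℝ (Fin 3)),
      IsSuitableWeakSolutionInBall 1 ((0 : ℝ), (0 : EuclideanSpace ℝ (Fin 3))) U P →
      HasWeakSpatialGradientOn
        (parabolicCylinderOpens 1 ((0 : ℝ), (0 : EuclideanSpace ℝ (Fin 3)))) U G →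
      ∫⁻ w in parabolicCylinder 1 ((0 : ℝ), (0 : EuclideanSpace ℝ (Fin 3))),
          (‖U w.1 w.2‖ₑ ^ (3 : ℕ) + ‖P w.1 w.2‖ₑ ^ (3 / 2 : ℝ)) < ENNReal.ofReal ε₂ →
      ∀ᵐ w ∂(volume.restrict (parabolicCylinder (1 / 2) ((0 : ℝ), (0 : EuclideanSpace ℝ (Fin 3))))),
        Real.sqrt (frobeniusNormSq (G w.1 w.2)) < c₀₂)
    {Q : Opens (ℝ × EuclideanSpace ℝ (Fin 3))}
    {v : ℝ → EuclideanSpace ℝ (Fin 3) → EuclideanSpace ℝ (Fin 3)} {p : ℝ → EuclideanSpace ℝ (Fin 3) → ℝ}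
    {G : ℝ → EuclideanSpace ℝ (Fin 3) → EuclideanSpace ℝ (Fin 3) →L[ℝ] EuclideanSpace ℝ (Fin 3)}
    (hsw : IsSuitableWeakSolutionOn Q 1 0 v p) (hG : HasWeakSpatialGradientOn Q v G)
    {z : ℝ × EuclideanSpace ℝ (Fin 3)} {r : ℝ} (hr : 0 < r)
    (hbox : Icc (z.1 - r ^ 2) z.1 ×ˢ closedBall z.2 r ⊆ (Q : Set (ℝ × EuclideanSpace ℝ (Fin 3))))
    (hsmall : ∫⁻ w in parabolicCylinder r z, (‖v w.1 w.2‖ₑ ^ (3 : ℕ) + ‖p w.1 w.2‖ₑ ^ (3 / 2 : ℝ)) <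
      ENNReal.ofReal (ε₂ * r ^ 2)) :
    ∀ᵐ w ∂(volume.restrict (parabolicCylinder (r / 2) z)),
      Real.sqrt (frobeniusNormSq (G w.1 w.2)) ≤ c₀₂ / r ^ 2 := by
  have hr2 : 0 < r ^ 2 := pow_pos hr 2
  -- the class on the ball `Q_r(z)` and its zoom to `Q(0, 1)`
  have hball : IsSuitableWeakSolutionInBall r z v p := hsw.isSuitableWeakSolutionInBall hbox
  have hzoom : IsSuitableWeakSolutionInBall 1 ((0 : ℝ), (0 : EuclideanSpace ℝ (Fin 3)))
      (r • stPull (r ^ 2) r z.1 z.2 v) (r ^ 2 • stPull (r ^ 2) r z.1 z.2 p) := hball.zoom hr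
  have hQr : parabolicCylinderOpens r z ≤ Q :=
    (parabolicCylinder_subset_Icc_prod_closedBall z r).trans hbox
  have hpreO : stPreimage (r ^ 2) r z.1 z.2 (parabolicCylinderOpens r z) =
      parabolicCylinderOpens 1 ((0 : ℝ), (0 : EuclideanSpace ℝ (Fin 3))) :=
    zoom_stPreimage_parabolicCylinderOpens hr z
  have hpre_half : stAffine (r ^ 2) r z.1 z.2 ⁻¹' parabolicCylinder (r / 2) z =
      parabolicCylinder (1 / 2) ((0 : ℝ), (0 : EuclideanSpace ℝ (Fin 3))) :=
    zoom_preimage_parabolicCylinder_half hr z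
  -- the weak gradient of the zoomed field
  have hGz : HasWeakSpatialGradientOn
      (parabolicCylinderOpens 1 ((0 : ℝ), (0 : EuclideanSpace ℝ (Fin 3))))
      (r • stPull (r ^ 2) r z.1 z.2 v) ((r * r) • stPull (r ^ 2) r z.1 z.2 G) := by
    have h1 := (hG.mono hQr).stRescale r hr2 hr z.1 z.2
    rw [hpreO] at h1
    exact h1
  -- the smallness quantity of the zoomed pair
  have hsmz : ∫⁻ w in parabolicCylinder 1 ((0 : ℝ), (0 : EuclideanSpace ℝ (Fin 3))),
      (‖(r • stPull (r ^ 2) r z.1 z.2 v) w.1 w.2‖ₑ ^ (3 : ℕ) +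
        ‖(r ^ 2 • stPull (r ^ 2) r z.1 z.2 p) w.1 w.2‖ₑ ^ (3 / 2 : ℝ)) < ENNReal.ofReal ε₂ := by
    rw [lintegral_cube_add_pressure_zoom hr z v p]
    have h0 : ENNReal.ofReal ((r ^ 2)⁻¹) ≠ 0 := (ENNReal.ofReal_pos.2 (inv_pos.2 hr2)).ne'
    calc ENNReal.ofReal ((r ^ 2)⁻¹) *
          ∫⁻ w in parabolicCylinder r z, (‖v w.1 w.2‖ₑ ^ (3 : ℕ) + ‖p w.1 w.2‖ₑ ^ (3 / 2 : ℝ))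
        < ENNReal.ofReal ((r ^ 2)⁻¹) * ENNReal.ofReal (ε₂ * r ^ 2) :=
          ENNReal.mul_lt_mul_right h0 ENNReal.ofReal_ne_top hsmall
      _ = ENNReal.ofReal ε₂ := by
          rw [← ENNReal.ofReal_mul (inv_nonneg.2 (sq_nonneg r))]
          congr 1
          field_simp
  -- Lemma 6.1 (`k = 2`) on the zoom, transported back along `Φ`
  have hae := H _ _ _ hzoom hGz hsmz
  rw [← hpre_half] at hae
  refine ae_restrict_of_ae_restrict_preimage_stAffine hr2 hr z.1 z.2
    (P := fun w => Real.sqrt (frobeniusNormSq (G w.1 w.2)) ≤ c₀₂ / r ^ 2) ?_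
  filter_upwards [hae] with w hw
  have e : ((r * r) • stPull (r ^ 2) r z.1 z.2 G) w.1 w.2 =
      (r * r) • G (stAffine (r ^ 2) r z.1 z.2 w).1 (stAffine (r ^ 2) r z.1 z.2 w).2 := rfl
  rw [e, frobeniusNormSq_smul, Real.sqrt_mul (sq_nonneg _), Real.sqrt_sq (by positivity)] at hw
  rw [le_div_iff₀ hr2]
  calc Real.sqrt (frobeniusNormSq (G (stAffine (r ^ 2) r z.1 z.2 w).1
        (stAffine (r ^ 2) r z.1 z.2 w).2)) * r ^ 2
      = r * r * Real.sqrt (frobeniusNormSq (G (stAffine (r ^ 2) r z.1 z.2 w).1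
          (stAffine (r ^ 2) r z.1 z.2 w).2)) := by ring
    _ ≤ c₀₂ := hw.le

/-! ### Theorem 1 of Barker–Prange in quantitative slab form -/

set_option maxHeartbeats 4000000 in
/-- **Barker–Prange 2020, Theorem 1, quantitative slab form (velocity AND gradient envelopes).**
There are a universal `γ > 0` and, for every `M > 0`, a time `S = S(M) ∈ (0, ¼]` and, for every
`β ∈ (0, S)`, constants `C, C₁ > 0` (depending on `M`, `β` only — in fact on `β` and universal
constants) such that: for every local energy solution `(v, π)` on `ℝ³ × (0, S)` with unit
viscosity (`IsLocalEnergySolutionOn S 1 v₀ v π`, Seregin 2014 Def. B.1 = the paper's Def. 16 on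
the finite strip) whose datum lies in `E²` (`MemE2`) with `‖v₀‖_{L²(B₁(x̄))} ≤ M` for all `x̄` and
`‖v₀‖_{L³(B₂(0))} ≤ γ`,
(i) `|v| ≤ C` almost everywhere on `(β, S) × B_{1/3}(0)`;
(ii) hence `‖v‖_{L^∞((β, S) × B_{1/3}(0))} ≤ C`;
(iii) every weak spatial gradient `G` of `v` on the open strip `(0, S) × ℝ³`
(`HasWeakSpatialGradientOn (slab _ (Ioo 0 S) _) v G`; the class carries one, and for a field that
is `C¹` in space the classical gradient is one) satisfies `|G| ≤ C₁` almost everywhere on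
`(β, S) × B_{1/3}(0)`, `|G| = √(frobeniusNormSq G)`.
The printed Theorem 1 (arXiv:1812.09115 p. 2) is the qualitative `u ∈ L^∞(B_{1/3} × (β, S*(M)))`,
in the tree as `BarkerPrange2020_thm1_slab`; the velocity bound with constants fixed before the
solution is Kang–Miura–Tsai 2021 Thm. 1.1 / Cor. 1.2 (`|v| ≤ C₁/√t` on `B_{1/4} × (0, T₁(M))`);
the gradient bound is the case `k = 2` of the ε-regularity lemma (Seregin 2014, Lemma 6.1) on
the same cylinders. Proof: module docstring (the initial-time CKN induction of
`BarkerPrange2020_thm1_slab`, then `lemarieRieusset_epsilon_regularity_holds` and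
`ae_gradient_bound_of_small` with `seregin2014_lemma61_gradient` on the interior cylinders of the
dyadic scale `r(β)`, `r² < β`, and a countable covering).
[cite: BarkerPrange2020, Thm. 1 (arXiv:1812.09115 p. 2) with the remark following it and §4.1; KangMiuraTsai2020, Thm. 1.1 / Cor. 1.2; Seregin2014, Ch. 6 Lemma 6.1 (k = 1, 2)] -/
theorem BarkerPrange2020_thm1_slab_bounds :
    ∃ γ : ℝ, 0 < γ ∧ ∀ M : ℝ, 0 < M → ∃ S : ℝ, 0 < S ∧ S ≤ 1 / 4 ∧ ∀ β ∈ Ioo 0 S,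
      ∃ C C₁ : ℝ, 0 < C ∧ 0 < C₁ ∧
      ∀ (v₀ : EuclideanSpace ℝ (Fin 3) → EuclideanSpace ℝ (Fin 3))
        (v : ℝ → EuclideanSpace ℝ (Fin 3) → EuclideanSpace ℝ (Fin 3))
        (π : ℝ → EuclideanSpace ℝ (Fin 3) → ℝ),
        IsLocalEnergySolutionOn S 1 v₀ v π → MemE2 v₀ →
        (∀ x₁ : EuclideanSpace ℝ (Fin 3),
          eLpNorm v₀ 2 (volume.restrict (ball x₁ 1)) ≤ ENNReal.ofReal M) →
        eLpNorm v₀ 3 (volume.restrict (ball (0 : EuclideanSpace ℝ (Fin 3)) 2)) ≤ ENNReal.ofReal γ →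
        (∀ᵐ w ∂(volume.restrict (Ioo β S ×ˢ ball (0 : EuclideanSpace ℝ (Fin 3)) (1 / 3))),
            ‖v w.1 w.2‖ ≤ C) ∧
        eLpNorm (uncurry v) ∞
            (volume.restrict (Ioo β S ×ˢ ball (0 : EuclideanSpace ℝ (Fin 3)) (1 / 3))) ≤
          ENNReal.ofReal C ∧
        ∀ G : ℝ → EuclideanSpace ℝ (Fin 3) → EuclideanSpace ℝ (Fin 3) →L[ℝ] EuclideanSpace ℝ (Fin 3),
          HasWeakSpatialGradientOn (slab (EuclideanSpace ℝ (Fin 3)) (Ioo 0 S) isOpen_Ioo) v G →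
          ∀ᵐ w ∂(volume.restrict (Ioo β S ×ˢ ball (0 : EuclideanSpace ℝ (Fin 3)) (1 / 3))),
            Real.sqrt (frobeniusNormSq (G w.1 w.2)) ≤ C₁ := by
  -- ## universal constants
  obtain ⟨εs, hεs, Hind⟩ := initialInduction
  obtain ⟨εL, C₀, hεL, hC₀, HLR⟩ := lemarieRieusset_epsilon_regularity_holds 1 3 one_pos (by norm_num)
  obtain ⟨ε₂, c₀₂, hε₂, hc₀₂, H61⟩ :=
    (seregin2014_lemma61_gradient_of_higherRegularityBounds NSBoundedHigherRegularityBounds_holds).ae_bound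
  set ε₀ : ℝ := min εs (min ((εL ^ 3 / 2) ^ (3 / 2 : ℝ)) ((ε₂ / 2) ^ (3 / 2 : ℝ))) with hε₀
  have hε₀pos : 0 < ε₀ :=
    lt_min hεs (lt_min (Real.rpow_pos_of_pos (by positivity) _) (Real.rpow_pos_of_pos (by positivity) _))
  have hε₀εs : ε₀ ≤ εs := min_le_left _ _
  set m : ℝ := ε₀ ^ (2 / 3 : ℝ) with hm
  have hm0 : 0 < m := Real.rpow_pos_of_pos hε₀pos _
  have hmL : 2 * m ≤ εL ^ 3 := by
    have h1 : ε₀ ≤ (εL ^ 3 / 2) ^ (3 / 2 : ℝ) := (min_le_right _ _).trans (min_le_left _ _)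
    have h2 : ε₀ ^ (2 / 3 : ℝ) ≤ ((εL ^ 3 / 2) ^ (3 / 2 : ℝ)) ^ (2 / 3 : ℝ) :=
      Real.rpow_le_rpow hε₀pos.le h1 (by norm_num)
    rw [← Real.rpow_mul (by positivity)] at h2
    norm_num at h2
    rw [hm]
    linarith
  have hmε₂ : m < ε₂ := by
    have h1 : ε₀ ≤ (ε₂ / 2) ^ (3 / 2 : ℝ) := (min_le_right _ _).trans (min_le_right _ _)
    have h2 : ε₀ ^ (2 / 3 : ℝ) ≤ ((ε₂ / 2) ^ (3 / 2 : ℝ)) ^ (2 / 3 : ℝ) :=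
      Real.rpow_le_rpow hε₀pos.le h1 (by norm_num)
    rw [← Real.rpow_mul (by positivity)] at h2
    norm_num at h2
    rw [hm]
    linarith
  set γ : ℝ := Real.sqrt (m / 2) with hγ
  have hγpos : 0 < γ := Real.sqrt_pos.2 (by positivity)
  have hγsq : 2 * γ ^ 2 = m := by rw [hγ, Real.sq_sqrt (by positivity)]; ring
  refine ⟨γ, hγpos, fun M hM => ?_⟩
  -- ## the time `S = S(M)`
  set α : ℝ≥0 := Real.toNNReal (M ^ 2 / 2) with hα
  obtain ⟨S₀, hS₀, -, Hsmall⟩ := exists_unitScale_small α hε₀pos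
  set S : ℝ := min S₀ (1 / 4) with hSdef
  have hS : 0 < S := lt_min hS₀ (by norm_num)
  have hS4 : S ≤ 1 / 4 := min_le_right _ _
  have hSS₀ : S ≤ S₀ := min_le_left _ _
  refine ⟨S, hS, hS4, fun β hβ => ?_⟩
  -- ## the scale `r = r_n(β)` with `r ≤ 1/4`, `r² < β`, and the two constants
  obtain ⟨n, hnlt⟩ := exists_pow_lt_of_lt_one (show 0 < min (Real.sqrt β / 2) (1 / 4) by
    have := hβ.1; positivity) (by norm_num : (1 / 2 : ℝ) < 1)
  set r : ℝ := rad n with hrdef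
  have hr : 0 < r := rad_pos n
  have hreq : r = (1 / 2 : ℝ) ^ n := rfl
  have hr4 : r ≤ 1 / 4 := by rw [hreq]; exact (hnlt.le).trans (min_le_right _ _)
  have hrβ : r ^ 2 < β := by
    have h1 : r < Real.sqrt β / 2 := by rw [hreq]; exact lt_of_lt_of_le hnlt (min_le_left _ _)
    have h2 : r < Real.sqrt β := by linarith [Real.sqrt_nonneg β]
    calc r ^ 2 < Real.sqrt β ^ 2 := by gcongr
      _ = β := Real.sq_sqrt hβ.1.le
  have hn1 : 1 ≤ n := by
    by_contra h0
    push Not at h0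
    interval_cases n
    simp [hreq] at hr4
    linarith
  have hr2 : 0 < r ^ 2 := pow_pos hr 2
  set B : ℝ := C₀ * εL / r with hB
  have hBpos : 0 < B := by rw [hB]; positivity
  have hB₁pos : 0 < c₀₂ / r ^ 2 := by positivity
  refine ⟨B, c₀₂ / r ^ 2, hBpos, hB₁pos, fun v₀ v π h hE2 hMb hγb => ?_⟩
  -- ## the datum
  have hm₀ : AEStronglyMeasurable v₀ volume := hE2.aestronglyMeasurable
  have hdat : ∀ x₀ : EuclideanSpace ℝ (Fin 3), ∫⁻ x in ball x₀ 1, ‖v₀ x‖ₑ ^ 2 ≤ 2 * (α : ℝ≥0∞) := by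
    intro x₀
    refine (lintegral_unitBall_sq_le_of_eLpNorm hM.le (hMb x₀)).trans (le_of_eq ?_)
    rw [show M ^ 2 = 2 * (M ^ 2 / 2) by ring, ENNReal.ofReal_mul zero_le_two, ENNReal.ofReal_ofNat]
    rfl
  -- ## unit-scale smallness and the weak gradient of the class
  obtain ⟨G, hG, hGR, hsmallS⟩ := Hsmall S hS hSS₀ v₀ v π hm₀ h hdat
  -- ## the gauge and the gauged solution
  set c : ℝ → ℝ := fun t => ⨍ y in ball (0 : EuclideanSpace ℝ (Fin 3)) 1, π t y with hc
  have hcL : MemLp c (3 / 2 : ℝ≥0∞) (volume.restrict (Ioo 0 S)) :=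
    h.isLocalLeraySolutionOn.memLp_setAverage_pressure 0 one_pos
  set π' : ℝ → EuclideanSpace ℝ (Fin 3) → ℝ := fun t x => π t x - c t with hπ'
  have h' : IsLocalEnergySolutionOn S 1 v₀ v π' := h.sub_timeGauge hcL
  -- ## the zero extensions
  set U : ℝ → EuclideanSpace ℝ (Fin 3) → EuclideanSpace ℝ (Fin 3) :=
    fun t x => if t ∈ Ioo 0 S then v t x else 0 with hU
  set P : ℝ → EuclideanSpace ℝ (Fin 3) → ℝ := fun t x => if t ∈ Ioo 0 S then π' t x else 0 with hP
  set Gt : ℝ → EuclideanSpace ℝ (Fin 3) → EuclideanSpace ℝ (Fin 3) →L[ℝ] EuclideanSpace ℝ (Fin 3) :=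
    fun t x => if t ∈ Ioo 0 S then G t x else 0 with hGt
  have hUin : ∀ t ∈ Ioo 0 S, U t = v t := fun t ht => funext fun x => if_pos ht
  have hUout : ∀ t, t ∉ Ioo 0 S → U t = 0 := fun t ht => funext fun x => if_neg ht
  have hPin : ∀ t ∈ Ioo 0 S, P t = π' t := fun t ht => funext fun x => if_pos ht
  have hPout : ∀ t, t ∉ Ioo 0 S → P t = 0 := fun t ht => funext fun x => if_neg ht
  have hGin : ∀ t ∈ Ioo 0 S, Gt t = G t := fun t ht => funext fun x => if_pos ht
  have hGout : ∀ t, t ∉ Ioo 0 S → Gt t = 0 := fun t ht => funext fun x => if_neg ht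
  -- ## the unit cylinder at the apex `z₀ = (S, 0)`
  set z₀ : ℝ × EuclideanSpace ℝ (Fin 3) := (S, 0) with hz₀
  have hQ1sub : parabolicCylinder 1 z₀ ⊆ {w | w.1 < S} := fun w hw => (mem_parabolicCylinder.1 hw).1.2
  have hGw : HasWeakSpatialGradientOn (parabolicCylinderOpens 1 z₀) U Gt :=
    (hasWeakSpatialGradientOn_extension h hS hG hGR hUin hUout hGin hGout).mono le_top
  have hG2 := lintegral_cylinder_frobeniusNormSq_extension_lt_top (T := S) hGR hGin hGout z₀
  have hp_li := locallyIntegrableOn_pressure_extension h' hPin hPout (parabolicCylinder 1 z₀)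
  have hp32 := lintegral_cylinder_pressure_extension_lt_top h' hPin hPout z₀
  have hdivQ : ∀ θ : ℝ → EuclideanSpace ℝ (Fin 3) → ℝ, IsSpaceTimeTestOn (parabolicCylinderOpens 1 z₀) θ →
      ∫ w in parabolicCylinder 1 z₀, ⟪U w.1 w.2, gradient (θ w.1) w.2⟫ = 0 := by
    intro θ hθ
    have key := integral_inner_gradient_extension_eq_zero h hS hUin hUout (hθ.mono le_top)
    rw [← key]
    refine setIntegral_eq_integral_of_forall_compl_eq_zero fun w hw => ?_
    obtain ⟨-, -, hg0⟩ := hθ.continuous_gradient_field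
    rw [hg0 w (fun h'' => hw (hθ.tsupport_subset h'')), inner_zero_right]
  have hPeqQ : ∀ φ : ℝ → EuclideanSpace ℝ (Fin 3) → ℝ, IsSpaceTimeTestOn (parabolicCylinderOpens 1 z₀) φ →
      ∫ w in parabolicCylinder 1 z₀,
        (⟪U w.1 w.2, convect (U w.1) (gradient (φ w.1)) w.2⟫ + P w.1 w.2 * Δ (φ w.1) w.2) = 0 := by
    intro φ hφ
    have key := pressureEq_extension h' hS hUin hUout hPin hPout (hφ.mono le_top)
    rw [← key]
    refine setIntegral_eq_integral_of_forall_compl_eq_zero fun w hw => ?_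
    have hw' : (w.1, w.2) ∉ ((parabolicCylinderOpens 1 z₀ : Opens (ℝ × EuclideanSpace ℝ (Fin 3))) :
        Set (ℝ × EuclideanSpace ℝ (Fin 3))) := hw
    rw [hφ.convect_gradient_eq_zero hw' _, hφ.laplacian_slice_eq_zero hw', inner_zero_right, mul_zero,
      add_zero]
  have hLEIQ : ∀ φ : ℝ → EuclideanSpace ℝ (Fin 3) → ℝ, IsSpaceTimeTestOn (parabolicCylinderOpens 1 z₀) φ →
      (∀ t x, 0 ≤ φ t x) →
      2 * 1 * ∫ t, ∫ x, frobeniusNormSq (Gt t x) * φ t x ≤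
        (∫ x, ‖v₀ x‖ ^ 2 * φ 0 x) +
          ∫ t, ∫ x, (‖U t x‖ ^ 2 * (timeDeriv φ t x + 1 * Δ (φ t) x) +
            (‖U t x‖ ^ 2 + 2 * P t x) * ⟪U t x, gradient (φ t) x⟫) := by
    intro φ hφ hφ0
    have hφ' : IsSpaceTimeTestOn (slab (EuclideanSpace ℝ (Fin 3)) (Iio S) isOpen_Iio) φ :=
      hφ.of_tsupport_subset fun w hw => mem_slab.2 (hQ1sub (hφ.tsupport_subset hw))
    exact localEnergyIneq_datum_extension h' hS hm₀ hG hGR hUin hUout hPin hPout hGin hGout hφ' hφ0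
  -- ## the one-scale smallness of the extension
  set Sl : Set (ℝ × EuclideanSpace ℝ (Fin 3)) := Ioo 0 S ×ˢ (univ : Set (EuclideanSpace ℝ (Fin 3))) with hSl
  have hSlm : MeasurableSet Sl := measurableSet_Ioo.prod MeasurableSet.univ
  have hsmall : RRS2016.Small ε₀ U P z₀ := by
    unfold RRS2016.Small
    have e : (fun w : ℝ × EuclideanSpace ℝ (Fin 3) => ‖U w.1 w.2‖ₑ ^ (3 : ℕ) + ‖P w.1 w.2‖ₑ ^ (3 / 2 : ℝ)) =
        Sl.indicator fun w => ‖v w.1 w.2‖ₑ ^ (3 : ℕ) +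
          ‖π w.1 w.2 - ⨍ y in ball (0 : EuclideanSpace ℝ (Fin 3)) 1, π w.1 y‖ₑ ^ (3 / 2 : ℝ) := by
      funext w
      by_cases hw : w ∈ Sl
      · rw [indicator_of_mem hw]
        simp only [hU, hP, hπ', hc, if_pos hw.1]
      · rw [indicator_of_notMem hw]
        have : w.1 ∉ Ioo 0 S := fun h'' => hw ⟨h'', mem_univ _⟩
        simp only [hU, hP, if_neg this, enorm_zero, ENNReal.zero_rpow_of_pos (by norm_num : (0 : ℝ) < 3 / 2),
          add_zero, pow_succ, mul_zero]
    rw [e, lintegral_indicator hSlm, Measure.restrict_restrict hSlm]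
    have hsub : Sl ∩ parabolicCylinder 1 z₀ ⊆ Ioo 0 S ×ˢ ball (0 : EuclideanSpace ℝ (Fin 3)) 1 := fun w hw =>
      ⟨hw.1.1, (mem_parabolicCylinder.1 hw.2).2⟩
    exact (lintegral_mono_set hsub).trans (hsmallS 0)
  -- ## the induction: smallness at all dyadic scales
  have hA : ∀ z ∈ parabolicCylinder (1 / 2) z₀, z.2 ∈ ball (0 : EuclideanSpace ℝ (Fin 3)) (1 / 2) →
      ∀ n : ℕ, 1 ≤ n → cknC (rad n) z U + cknDOsc (rad n) z P ≤ ENNReal.ofReal (ε₀ ^ (2 / 3 : ℝ)) := by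
    intro z hz hz2 n hn
    refine Hind z₀ v₀ U P Gt hGw hG2 hp_li hp32 hdivQ hPeqQ hLEIQ ε₀ hε₀pos hε₀εs hsmall z hz ?_ n hn
    intro ρ hρ hρ1
    refine (lintegral_ball_sq_le_of_cube hm₀ hγpos.le hγb hz2 hρ hρ1).trans (le_of_eq ?_)
    rw [show 2 * γ ^ 2 * ρ = (2 * γ ^ 2) * ρ by ring, hγsq]
  -- ## the bounds on the interior cylinders hanging from admissible apices
  have hapex : ∀ t ∈ Ioo β S, ∀ xb ∈ ball (0 : EuclideanSpace ℝ (Fin 3)) (1 / 2),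
      (∀ᵐ w ∂(volume.restrict (parabolicCylinder (r / 2) (t, xb))), ‖v w.1 w.2‖ ≤ B) ∧
      ∀ Gu : ℝ → EuclideanSpace ℝ (Fin 3) → EuclideanSpace ℝ (Fin 3) →L[ℝ] EuclideanSpace ℝ (Fin 3),
        HasWeakSpatialGradientOn (slab (EuclideanSpace ℝ (Fin 3)) (Ioo 0 S) isOpen_Ioo) v Gu →
        ∀ᵐ w ∂(volume.restrict (parabolicCylinder (r / 2) (t, xb))),
          Real.sqrt (frobeniusNormSq (Gu w.1 w.2)) ≤ c₀₂ / r ^ 2 := by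
    intro t ht xb hxb
    set z : ℝ × EuclideanSpace ℝ (Fin 3) := (t, xb) with hzdef
    have hz : z ∈ parabolicCylinder (1 / 2) z₀ := by
      rw [mem_parabolicCylinder]
      refine ⟨⟨?_, ht.2⟩, by simpa [hz₀] using hxb⟩
      show S - (1 / 2) ^ 2 < t
      linarith [ht.1, hβ.1]
    have hAz := hA z hz (by simpa using hxb) n hn1
    -- `Q_r(z)` and its closed box lie in the open slab
    set Qr := parabolicCylinder r z with hQr
    have htr : 0 < t - r ^ 2 := by linarith [ht.1]
    have hQr_slab : Qr ⊆ Sl := fun w hw =>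
      ⟨⟨lt_trans htr (mem_parabolicCylinder.1 hw).1.1, lt_trans (mem_parabolicCylinder.1 hw).1.2 ht.2⟩, mem_univ _⟩
    have hQrO : (parabolicCylinderOpens r z : Opens (ℝ × EuclideanSpace ℝ (Fin 3))) ≤
        slab (EuclideanSpace ℝ (Fin 3)) (Ioo 0 S) isOpen_Ioo := hQr_slab
    have hbox : Icc (z.1 - r ^ 2) z.1 ×ˢ closedBall z.2 r ⊆
        ((slab (EuclideanSpace ℝ (Fin 3)) (Ioo 0 S) isOpen_Ioo : Opens (ℝ × EuclideanSpace ℝ (Fin 3))) :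
          Set (ℝ × EuclideanSpace ℝ (Fin 3))) := fun w hw =>
      ⟨⟨lt_of_lt_of_le htr hw.1.1, lt_of_le_of_lt hw.1.2 ht.2⟩, mem_univ _⟩
    -- the doubly gauged pressure on the slab
    set m₂ : ℝ → ℝ := fun s => ⨍ y in ball xb r, π' s y with hm₂
    have hm₂L : MemLp m₂ (3 / 2 : ℝ≥0∞) (volume.restrict (Ioo 0 S)) :=
      h'.isLocalLeraySolutionOn.memLp_setAverage_pressure xb hr
    set p'' : ℝ → EuclideanSpace ℝ (Fin 3) → ℝ := fun s y => π' s y - m₂ s with hp''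
    have hsw : IsSuitableWeakSolutionOn (slab (EuclideanSpace ℝ (Fin 3)) (Ioo 0 S) isOpen_Ioo) 1 0 v p'' :=
      h'.suitable.sub_timeGauge_slab hm₂L
    obtain ⟨G'', hG'', hG''2, hLEI''⟩ := hsw.localEnergy
    -- smallness on `Q_r(z)`
    have hmeas3 : AEMeasurable (fun w : ℝ × EuclideanSpace ℝ (Fin 3) => ‖v w.1 w.2‖ₑ ^ (3 : ℕ))
        (volume.restrict Qr) :=
      ((h.aestronglyMeasurable.mono_measure (Measure.restrict_mono hQr_slab le_rfl)).enorm.pow_const _)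
    have hsm0 : ∫⁻ w in Qr, (‖v w.1 w.2‖ₑ ^ (3 : ℕ) + ‖p'' w.1 w.2‖ₑ ^ (3 / 2 : ℝ)) ≤
        ENNReal.ofReal (r ^ 2 * m) := by
      have hQm : MeasurableSet Qr := (isOpen_parabolicCylinder r z).measurableSet
      have e1 : ∫⁻ w in Qr, ‖v w.1 w.2‖ₑ ^ (3 : ℕ) = ENNReal.ofReal r ^ 2 * cknC r z U := by
        rw [← lintegral_cube_eq_mul_cknC hr z U]
        refine setLIntegral_congr_fun hQm fun w hw => ?_
        rw [hUin w.1 (hQr_slab hw).1]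
      have e2 : ∫⁻ w in Qr, ‖p'' w.1 w.2‖ₑ ^ (3 / 2 : ℝ) = ENNReal.ofReal r ^ 2 * cknDOsc r z P := by
        have h0 : ENNReal.ofReal r ^ 2 ≠ 0 := pow_ne_zero _ (ENNReal.ofReal_pos.2 hr).ne'
        have htop : ENNReal.ofReal r ^ 2 ≠ ∞ := ENNReal.pow_ne_top ENNReal.ofReal_ne_top
        rw [cknDOsc, ← mul_assoc, ENNReal.mul_inv_cancel h0 htop, one_mul]
        refine setLIntegral_congr_fun hQm fun w hw => ?_
        have hPw : P w.1 = π' w.1 := hPin w.1 (hQr_slab hw).1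
        simp only [hp'', hm₂, hPw]
        rfl
      rw [lintegral_add_left' hmeas3, e1, e2, ← mul_add]
      calc ENNReal.ofReal r ^ 2 * (cknC r z U + cknDOsc r z P)
          ≤ ENNReal.ofReal r ^ 2 * ENNReal.ofReal (ε₀ ^ (2 / 3 : ℝ)) := by gcongr
        _ = ENNReal.ofReal (r ^ 2 * ε₀ ^ (2 / 3 : ℝ)) := by
            rw [← ENNReal.ofReal_pow hr.le, ← ENNReal.ofReal_mul (by positivity)]
        _ = ENNReal.ofReal (r ^ 2 * m) := by rw [hm]
    have hsm : ∫⁻ w in Qr, (‖v w.1 w.2‖ₑ ^ (3 : ℕ) + ‖p'' w.1 w.2‖ₑ ^ (3 / 2 : ℝ)) ≤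
        ENNReal.ofReal (εL ^ 3 * r ^ 2) := by
      refine hsm0.trans (ENNReal.ofReal_le_ofReal ?_)
      nlinarith [hm0, pow_pos hr 2]
    have hsmg : ∫⁻ w in Qr, (‖v w.1 w.2‖ₑ ^ (3 : ℕ) + ‖p'' w.1 w.2‖ₑ ^ (3 / 2 : ℝ)) <
        ENNReal.ofReal (ε₂ * r ^ 2) := by
      refine lt_of_le_of_lt hsm0 ((ENNReal.ofReal_lt_ofReal_iff (by positivity)).2 ?_)
      nlinarith [hmε₂, pow_pos hr 2]
    refine ⟨?_, fun Gu hGu => ae_gradient_bound_of_small H61 hsw hGu hr hbox hsmg⟩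
    -- the hypotheses of Thm. 14.4 on `Q_r(z)`
    have hconn := BarkerPrange2020.isConnected_parabolicCylinder hr z
    have henergy : ∃ C : ℝ≥0, ∀ᵐ s : ℝ,
        ∫⁻ y, ((parabolicCylinderOpens r z : Opens (ℝ × EuclideanSpace ℝ (Fin 3))) :
          Set (ℝ × EuclideanSpace ℝ (Fin 3))).indicator
            (fun w : ℝ × EuclideanSpace ℝ (Fin 3) => ‖v w.1 w.2‖ₑ ^ 2) (s, y) ≤ C := by
      obtain ⟨CE, hCE⟩ := h.uniformLocalEnergy
      refine ⟨CE, ae_of_all _ fun s => ?_⟩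
      by_cases hs : s ∈ Ioo (t - r ^ 2) t
      · have e : (fun y => ((parabolicCylinderOpens r z : Opens (ℝ × EuclideanSpace ℝ (Fin 3))) :
            Set (ℝ × EuclideanSpace ℝ (Fin 3))).indicator
              (fun w : ℝ × EuclideanSpace ℝ (Fin 3) => ‖v w.1 w.2‖ₑ ^ 2) (s, y)) =
            (ball xb r).indicator fun y => ‖v s y‖ₑ ^ 2 := by
          funext y
          by_cases hy : y ∈ ball xb r
          · rw [indicator_of_mem hy, indicator_of_mem]
            exact mem_parabolicCylinder.2 ⟨hs, mem_ball.1 hy⟩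
          · rw [indicator_of_notMem hy, indicator_of_notMem]
            exact fun h'' => hy (mem_ball.2 (mem_parabolicCylinder.1 h'').2)
        rw [e, lintegral_indicator measurableSet_ball]
        have hsI : s ∈ Icc 0 S := ⟨(lt_trans htr hs.1).le, (lt_trans hs.2 ht.2).le⟩
        exact (lintegral_mono_set (ball_subset_ball (by linarith))).trans (hCE s hsI xb)
      · have e : (fun y => ((parabolicCylinderOpens r z : Opens (ℝ × EuclideanSpace ℝ (Fin 3))) :
            Set (ℝ × EuclideanSpace ℝ (Fin 3))).indicator
              (fun w : ℝ × EuclideanSpace ℝ (Fin 3) => ‖v w.1 w.2‖ₑ ^ 2) (s, y)) = fun _ => 0 := by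
          funext y
          rw [indicator_of_notMem]
          exact fun h'' => hs (mem_parabolicCylinder.1 h'').1
        rw [e, lintegral_zero]
        exact zero_le
    have hGQ : HasWeakSpatialGradientOn (parabolicCylinderOpens r z) v G'' := hG''.mono hQrO
    have hKcl : closure Qr ⊆ Sl := (closure_parabolicCylinder_subset r z).trans fun w hw =>
      ⟨⟨lt_of_lt_of_le htr hw.1.1, lt_of_le_of_lt hw.1.2 ht.2⟩, mem_univ _⟩
    have hKc : IsCompact (closure Qr) :=
      (isCompact_Icc.prod (isCompact_closedBall _ _)).of_isClosed_subset isClosed_closure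
        (closure_parabolicCylinder_subset r z)
    have hG''Q : ∫⁻ w in Qr, ENNReal.ofReal (frobeniusNormSq (G'' w.1 w.2)) < ∞ :=
      (lintegral_mono_set subset_closure).trans_lt (hG''2 _ hKcl hKc)
    have hp''Q : ∫⁻ w in Qr, ‖p'' w.1 w.2‖ₑ ^ (3 / 2 : ℝ) < ∞ :=
      lt_of_le_of_lt ((lintegral_mono fun w => le_add_self).trans hsm) ENNReal.ofReal_lt_top
    have hf : MemLp (uncurry (0 : ℝ → EuclideanSpace ℝ (Fin 3) → EuclideanSpace ℝ (Fin 3))) (ENNReal.ofReal 3)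
        (volume.restrict Qr) := MemLp.zero'
    have hns : IsDistributionalNSSolutionOn (parabolicCylinderOpens r z) 1 0 v p'' :=
      hsw.distributional.of_le hQrO
    have hLEIr : ∀ φ : ℝ → EuclideanSpace ℝ (Fin 3) → ℝ, IsSpaceTimeTestOn (parabolicCylinderOpens r z) φ →
        (∀ t x, 0 ≤ φ t x) →
        2 * 1 * ∫ t, ∫ x, frobeniusNormSq (G'' t x) * φ t x ≤
          ∫ t, ∫ x, (‖v t x‖ ^ 2 * (timeDeriv φ t x + 1 * Δ (φ t) x) +
            (‖v t x‖ ^ 2 + 2 * p'' t x) * ⟪v t x, gradient (φ t) x⟫ +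
            2 * ⟪(0 : ℝ → EuclideanSpace ℝ (Fin 3) → EuclideanSpace ℝ (Fin 3)) t x, v t x⟫ * φ t x) :=
      fun φ hφ hφ0 => hLEI'' φ (hφ.mono hQrO) hφ0
    have hforce : ∫⁻ w in parabolicCylinder r z,
        ‖(0 : ℝ → EuclideanSpace ℝ (Fin 3) → EuclideanSpace ℝ (Fin 3)) w.1 w.2‖ₑ ^ (3 : ℝ) ≤
          ENNReal.ofReal (εL ^ ((2 : ℝ) * 3) * r ^ ((5 : ℝ) - 3 * 3)) := by
      simp only [Pi.zero_apply, enorm_zero, ENNReal.zero_rpow_of_pos (by norm_num : (0 : ℝ) < 3), lintegral_zero]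
      exact zero_le
    have key := HLR (parabolicCylinderOpens r z) 0 v p'' G'' hconn henergy hGQ hG''Q hp''Q hf hns hLEIr z r εL hr
      Subset.rfl hεL.le le_rfl hsm hforce
    simpa [hB] using key
  -- ## the countable covering and the conclusion
  obtain ⟨D, hDc, hDd⟩ := TopologicalSpace.exists_countable_dense (EuclideanSpace ℝ (Fin 3))
  set A : Set (ℝ × EuclideanSpace ℝ (Fin 3)) :=
    (range (fun q : ℚ => (q : ℝ)) ∩ Ioo β S) ×ˢ (D ∩ ball (0 : EuclideanSpace ℝ (Fin 3)) (1 / 2)) with hAdef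
  have hAc : A.Countable :=
    ((countable_range _).mono inter_subset_left).prod (hDc.mono inter_subset_left)
  have hcover : Ioo β S ×ˢ ball (0 : EuclideanSpace ℝ (Fin 3)) (1 / 3) ⊆ ⋃ z ∈ A, parabolicCylinder (r / 2) z := by
    rintro ⟨s, x⟩ ⟨hs, hx⟩
    obtain ⟨xb, hxbD, hxb⟩ := hDd.exists_dist_lt x (show 0 < r / 2 by positivity)
    have hlt : s < min S (s + (r / 2) ^ 2) := lt_min hs.2 (by nlinarith [hr])
    obtain ⟨q, hq1, hq2⟩ := exists_rat_btwn hlt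
    have hqS : (q : ℝ) < S := lt_of_lt_of_le hq2 (min_le_left _ _)
    have hqs : (q : ℝ) < s + (r / 2) ^ 2 := lt_of_lt_of_le hq2 (min_le_right _ _)
    have hxb2 : xb ∈ ball (0 : EuclideanSpace ℝ (Fin 3)) (1 / 2) := by
      rw [mem_ball] at hx ⊢
      calc dist xb 0 ≤ dist xb x + dist x 0 := dist_triangle _ _ _
        _ < r / 2 + 1 / 3 := by rw [dist_comm]; exact add_lt_add hxb hx
        _ ≤ 1 / 2 := by linarith
    refine mem_iUnion₂.2 ⟨((q : ℝ), xb), ⟨⟨⟨q, rfl⟩, ⟨lt_trans hs.1 hq1, hqS⟩⟩, hxbD, hxb2⟩, ?_⟩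
    rw [mem_parabolicCylinder]
    exact ⟨⟨by simp only; linarith, hq1⟩, by simpa [dist_comm] using hxb⟩
  have haeV : ∀ᵐ w ∂(volume.restrict (Ioo β S ×ˢ ball (0 : EuclideanSpace ℝ (Fin 3)) (1 / 3))),
      ‖v w.1 w.2‖ ≤ B := by
    have hae : ∀ᵐ w ∂(volume.restrict (⋃ z ∈ A, parabolicCylinder (r / 2) z)), ‖v w.1 w.2‖ ≤ B := by
      rw [ae_restrict_biUnion_iff _ hAc]
      rintro ⟨tq, xb⟩ ⟨⟨-, htq⟩, -, hxb⟩
      exact (hapex tq htq xb hxb).1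
    exact ae_restrict_of_ae_restrict_of_subset hcover hae
  refine ⟨haeV, ?_, fun Gu hGu => ?_⟩
  · rw [eLpNorm_exponent_top]
    exact eLpNormEssSup_le_of_ae_bound haeV
  · have hae : ∀ᵐ w ∂(volume.restrict (⋃ z ∈ A, parabolicCylinder (r / 2) z)),
        Real.sqrt (frobeniusNormSq (Gu w.1 w.2)) ≤ c₀₂ / r ^ 2 := by
      rw [ae_restrict_biUnion_iff _ hAc]
      rintro ⟨tq, xb⟩ ⟨⟨-, htq⟩, -, hxb⟩
      exact (hapex tq htq xb hxb).2 Gu hGu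
    exact ae_restrict_of_ae_restrict_of_subset hcover hae

end Literature.Analysis.FluidPDE

end
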